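import Mathlib
import HarnessLib
import Summits.HubbardSuperconductivity.HubbardSuperconductivity.Theorems.KLProgrammeKLRegimeCountertermJacksonRemainderCert

/-!
# Route `KLProgramme`, crux K3 — gen-8 ENGINE-FLOW child (stmt-HubbardSuperconductivity-20437), stub (C) `stub_twoLeg_curvature`:
# the (C1) certificate consumer — the VALUE (`k = 0`) of the Jackson remainder

Seat hubbard-kl-k3c3-p1 (g7).  Companion of `flowPiece_reading_remainder_jets_of_cert` (orders `1 ≤ k ≤ 4`): from `CutoffDefectCert d cmax δ T`
and the same profile / frame data, `|J(θ)| ≤ a₁·Td + a₀·N0` for every base angle (door v3 at `k = 0`: no cutoff-jet terms, transport by the value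
increment `a₁·|⟨α_w(θ) − θ⟩|`, defect `a₀·|χ_w − 1|`).  Pure assembly; no definitions; nothing here asserts superconductivity.
-/

noncomputable section

namespace Summit.HubbardSuperconductivity.HubbardSuperconductivity.Theorems.KLRegimeSplit

set_option linter.dupNamespace false -- summit = problem name (single-conjunct summit), D-0017

open Real MeasureTheory Filter Set
open scoped Topology
open Literature.Analysis.Fourier.TrigApprox Literature.MathematicalPhysics.QuantumLattice
open Summit.HubbardSuperconductivity.HubbardSuperconductivity.Theorems.PerturbedFermiCurve

/-! ## §4 The value (`k = 0`) -/

section ValueBound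

variable {L M : ℕ} [NeZero L] [NeZero M]

/-- **The certificate bound of the VALUE of the Jackson remainder**: `|J(θ)| ≤ a₁·Td + a₀·N0` (every `θ`). -/
theorem flowPiece_reading_remainder_value_of_cert {d : ℕ} {cmax : ℝ} {δ : ℕ → ℝ} {T : CutoffDefectTable}
    (hcert : CutoffDefectCert d cmax δ T) (β U : ℝ) {μ : ℝ} (hμ : μ ∈ klWindowC) (n : ℕ) (hd : klFlowDeg n = d) (K' : TrigPolyC4v)
    (hf : ContDiff ℝ 5 fun θ : ℝ => klLocalPart L M β U μ (klFlowFrameU L M β U μ n) n θ)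
    (hon : ∀ θ, klFrameExtFn μ (fun θ => klLocalPart L M β U μ (klFlowFrameU L M β U μ n) n θ) (klFermiPoint μ K' θ) =
      klLocalPart L M β U μ (klFlowFrameU L M β U μ n) n θ)
    (hang : ∀ θ, klLocalPart L M β U μ (klFlowFrameU L M β U μ n) n (polarAngle (centredRep (klFermiPoint μ K' θ))) =
      klLocalPart L M β U μ (klFlowFrameU L M β U μ n) n θ)
    {a : ℕ → ℝ} (ha_nn : ∀ l, 0 ≤ a l)
    (ha0 : ∀ x, |klLocalPart L M β U μ (klFlowFrameU L M β U μ n) n x -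
      klAngularMean (fun θ => klLocalPart L M β U μ (klFlowFrameU L M β U μ n) n θ)| ≤ a 0)
    (ha : ∀ l, 1 ≤ l → l ≤ 5 → ∀ x, |iteratedDeriv l (fun x => klLocalPart L M β U μ (klFlowFrameU L M β U μ n) n x -
      klAngularMean (fun θ => klLocalPart L M β U μ (klFlowFrameU L M β U μ n) n θ)) x| ≤ a l)
    (hr : ContDiff ℝ 4 (perturbedFermiRadius (fun p => -K'.eval p) μ))
    (hflat : ∀ ϑ : ℝ, klFlatCutoffFn μ (klFermiPoint μ K' ϑ) = 1)
    (hlev : ∀ ϑ : ℝ, |freeBandFn (klFermiPoint μ K' ϑ) - μ| ≤ cmax)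
    (hjet : ∀ ϑ : ℝ, ∀ j ≤ 4, |iteratedDeriv j (perturbedFermiRadius (fun p => -K'.eval p) μ) ϑ -
      iteratedDeriv j (bandFermiRadius (freeBandFn (klFermiPoint μ K' ϑ))) ϑ| ≤ δ j)
    (θ : ℝ) :
    |klLocalPart L M β U μ (klFlowFrameU L M β U μ n) n θ - (klFlowPiece L M β U μ n).eval (klFermiPoint μ K' θ)| ≤
      a 1 * T.Td + a 0 * T.N0 := by
  -- periodic reduction to `θ₀ ∈ [−π, π]`
  set J : ℝ → ℝ := fun θ => klLocalPart L M β U μ (klFlowFrameU L M β U μ n) n θ - (klFlowPiece L M β U μ n).eval (klFermiPoint μ K' θ)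
    with hJ
  have hJper : Function.Periodic J (2 * π) := fun x => by
    simp only [hJ, klLocalPart_periodic β U μ _ n x, klFermiPoint_add_two_pi]
  set θ₀ := toIocMod Real.two_pi_pos (-π) θ with hθ₀
  obtain ⟨mz, hm⟩ : ∃ m : ℤ, θ = θ₀ + m • (2 * π) :=
    ⟨toIocDiv Real.two_pi_pos (-π) θ, (toIocMod_add_toIocDiv_zsmul Real.two_pi_pos (-π) θ).symm⟩
  have hθ₀mem : θ₀ ∈ Set.Icc (-π) π := by
    have h := toIocMod_mem_Ioc Real.two_pi_pos (-π) θ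
    exact ⟨h.1.le, by linarith [h.2]⟩
  have hval : J θ = J θ₀ := by rw [hm]; exact hJper.zsmul mz θ₀
  show |J θ| ≤ _
  rw [hval]
  -- now the door at `k = 0` on `θ₀`
  subst hd
  set f : ℝ → ℝ := fun θ => klLocalPart L M β U μ (klFlowFrameU L M β U μ n) n θ with hfdef
  set m : ℝ := klAngularMean f with hmdef
  set g : ℝ → ℝ := fun x => f x - m with hgdef
  set r : ℝ → ℝ := perturbedFermiRadius (fun p => -K'.eval p) μ with hrdef
  have hper : Function.Periodic f (2 * Real.pi) := klLocalPart_periodic β U μ _ n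
  have hgper : Function.Periodic g (2 * Real.pi) := fun x => by simp only [hgdef, hper x]
  have hg5 : ContDiff ℝ 5 g := hf.sub contDiff_const
  have hf4 : ContDiff ℝ 4 f := hf.of_le (by norm_num)
  have hγ : ContDiff ℝ 4 fun θ => (WithLp.toLp 2 (klFermiPoint μ K' θ) : EuclideanSpace ℝ (Fin 2)) := contDiff_certCurve hr
  set ν : ℝ := freeBandFn (klFermiPoint μ K' θ₀) with hνdef
  set c : ℝ := ν - μ with hcdef
  have hνc : ν - c = μ := by rw [hcdef]; ring
  have hc : c ∈ Set.Icc (-cmax) cmax := by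
    have h := hlev θ₀; rw [abs_le] at h; exact ⟨h.1, h.2⟩
  have hν : ν ∈ Set.Icc (-1.05 - cmax) (-0.15 + cmax) := by
    have h := hlev θ₀; rw [abs_le] at h
    simp only [klWindowC, Set.mem_Icc] at hμ
    constructor <;> linarith [hμ.1, hμ.2, h.1, h.2]
  obtain ⟨nq, mq, tq, uq, dq, hin, him, hit, hiu, hid, hae, hN0, hN, hMc, hTt, hTu, hTd⟩ :=
    hcert ν hν c hc θ₀ hθ₀mem r hr (hjet θ₀)
  simp only [hνc] at hae
  have hchain := ae_jmeas_chain_bounds_certAngle hr hg5 hgper ha θ₀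
  set pdef : ℕ → ℝ × ℝ → ℝ := fun _ _ => 0 with hpdef
  set tdef : ℝ × ℝ → ℝ := fun w => a 1 * dq w with htdef
  set edef : ℝ × ℝ → ℝ := fun w => a 0 * nq 0 w with hedef
  have hpint : ∀ i, 1 ≤ i → i ≤ 0 → Integrable (fun w => jweight (klFlowDeg n) w * pdef i w) jmeas := fun i h1 h0 => by omega
  have htint : Integrable (fun w => jweight (klFlowDeg n) w * tdef w) jmeas := by
    have e : (fun w => jweight (klFlowDeg n) w * tdef w) = fun w => a 1 * (jweight (klFlowDeg n) w * dq w) := by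
      funext w; simp only [htdef]; ring
    rw [e]; exact hid.const_mul _
  have heint : Integrable (fun w => jweight (klFlowDeg n) w * edef w) jmeas := by
    have e : (fun w => jweight (klFlowDeg n) w * edef w) = fun w => a 0 * (jweight (klFlowDeg n) w * nq 0 w) := by
      funext w; simp only [hedef]; ring
    rw [e]; exact (hin 0).const_mul _
  have hMx : ∀ i, 1 ≤ i → i ≤ 0 → ∫ w, jweight (klFlowDeg n) w * pdef i w ∂jmeas ≤ (0 : ℝ) := fun i h1 h0 => by omega
  have hTm : ∫ w, jweight (klFlowDeg n) w * tdef w ∂jmeas ≤ a 1 * T.Td := by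
    have e : (fun w => jweight (klFlowDeg n) w * tdef w) = fun w => a 1 * (jweight (klFlowDeg n) w * dq w) := by
      funext w; simp only [htdef]; ring
    rw [e, integral_const_mul]; exact mul_le_mul_of_nonneg_left hTd (ha_nn 1)
  have hEm : ∫ w, jweight (klFlowDeg n) w * edef w ∂jmeas ≤ a 0 * T.N0 := by
    have e : (fun w => jweight (klFlowDeg n) w * edef w) = fun w => a 0 * (jweight (klFlowDeg n) w * nq 0 w) := by
      funext w; simp only [hedef]; ring
    rw [e, integral_const_mul]; exact mul_le_mul_of_nonneg_left hN0 (ha_nn 0)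
  have hw : ∀ᵐ w ∂jmeas,
      (∀ i, 1 ≤ i → i ≤ 0 →
        |iteratedDeriv i (fun ϑ : ℝ =>
            klFlatCutoffFn μ (WithLp.ofLp ((WithLp.toLp 2 (klFermiPoint μ K' ϑ) : EuclideanSpace ℝ (Fin 2)) - jshift w))) θ₀| *
          |iteratedDeriv (0 - i) (fun ϑ : ℝ =>
            f (polarAngle (centredRep (WithLp.ofLp ((WithLp.toLp 2 (klFermiPoint μ K' ϑ) : EuclideanSpace ℝ (Fin 2)) - jshift w)))) -
              klAngularMean f) θ₀| ≤ pdef i w) ∧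
      |klFlatCutoffFn μ (WithLp.ofLp ((WithLp.toLp 2 (klFermiPoint μ K' θ₀) : EuclideanSpace ℝ (Fin 2)) - jshift w))| *
        |iteratedDeriv 0 (fun ϑ : ℝ =>
            f (polarAngle (centredRep (WithLp.ofLp ((WithLp.toLp 2 (klFermiPoint μ K' ϑ) : EuclideanSpace ℝ (Fin 2)) - jshift w)))) -
              klAngularMean f) θ₀ -
          iteratedDeriv 0 (fun ϑ : ℝ => f ϑ - klAngularMean f) θ₀| ≤ tdef w ∧
      |klFlatCutoffFn μ (WithLp.ofLp ((WithLp.toLp 2 (klFermiPoint μ K' θ₀) : EuclideanSpace ℝ (Fin 2)) - jshift w)) - 1| *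
        |iteratedDeriv 0 (fun ϑ : ℝ => f ϑ - klAngularMean f) θ₀| ≤ edef w := by
    filter_upwards [hae, hchain] with w h1 h2
    obtain ⟨hnq0, -, -, -, -, hdq⟩ := h1
    obtain ⟨-, -, -, hval0⟩ := h2
    have ecut0 : klFlatCutoffFn μ (WithLp.ofLp ((WithLp.toLp 2 (klFermiPoint μ K' θ₀) : EuclideanSpace ℝ (Fin 2)) - jshift w)) = certCutoff μ r w θ₀ := rfl
    refine ⟨fun i h1 h0 => by omega, ?_, ?_⟩
    · simp only [iteratedDeriv_zero, htdef, ecut0]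
      have h := hval0 θ₀
      have hχ0 : 0 ≤ |certCutoff μ r w θ₀| := abs_nonneg _
      calc |certCutoff μ r w θ₀| * |f (polarAngle (centredRep (WithLp.ofLp (certCurve r θ₀ - jshift w)))) - klAngularMean f - (f θ₀ - klAngularMean f)|
          = |certCutoff μ r w θ₀| * |g (certAngle r w θ₀) - g θ₀| := by rfl
        _ ≤ |certCutoff μ r w θ₀| * (a 1 * |toIocMod Real.two_pi_pos (-π) (certAngle r w θ₀ - θ₀)|) := mul_le_mul_of_nonneg_left h hχ0
        _ = a 1 * (|certCutoff μ r w θ₀| * |toIocMod Real.two_pi_pos (-π) (certAngle r w θ₀ - θ₀)|) := by ring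
        _ ≤ a 1 * dq w := mul_le_mul_of_nonneg_left hdq (ha_nn 1)
    · simp only [iteratedDeriv_zero, hedef, ecut0]
      calc |certCutoff μ r w θ₀ - 1| * |f θ₀ - klAngularMean f| ≤ nq 0 w * a 0 :=
            mul_le_mul hnq0 (ha0 θ₀) (abs_nonneg _) ((abs_nonneg _).trans hnq0)
        _ = a 0 * nq 0 w := mul_comm _ _
  have hmain := flowPiece_reading_remainder_jets_weightedMoments_ae (L := L) (M := M) β U hμ n K' hf4 hon hang hγ hflat (k := 0) (by norm_num) θ₀
    hpint htint heint hw hMx hTm hEm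
  simpa [iteratedDeriv_zero] using hmain

end ValueBound

end Summit.HubbardSuperconductivity.HubbardSuperconductivity.Theorems.KLRegimeSplit

end
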